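import Summits.CriticalPhenomena.Ising3DConformalLimit.Theorems.MoebiusLimitExists.Negative.CruxInversionOnly
import Summits.CriticalPhenomena.Ising3DConformalLimit.Theorems.MoebiusLimitExists.Negative.DeltaWindow
import Summits.CriticalPhenomena.Ising3DConformalLimit.Theorems.MoebiusLimitExists.Negative.TwoPointPositivity
import Summits.CriticalPhenomena.Ising3DConformalLimit.Theorems.EnergyNotSigmaSquaredMoebiusLimitExistsDefs

/-!
# `MoebiusLimit` (item stmt-CriticalPhenomena-1344): the renormalisation is WLOG the PINNED one,
and then non-degeneracy is automatic — the crux in two clauses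

Negative/structural knowledge about the crux `…Theses.EnergyNotSigmaSquared.MoebiusLimit`
(= `PerfectScreening.MoebiusLimitExists`), standing crux disprover gen 3 (D-0016); THEOREM-ONLY.
It concerns the objects of the picked line `only-interaction-breaks-moebius`
(`Theorems/EnergyNotSigmaSquaredMoebiusLimitExistsDefs.lean`: `rhoPin`, `PinnedLimit`).

* `rescaledCorrelator_rhoPin_unit`, `pinned_two_point_unit`: the pinned zoom is `≡ 1` at the unit
  axis pair, so every pinned limit has `S₂(0, e₀) = 1`; with the dichotomy of
  `Negative/TwoPointPositivity.lean`, `isNondegenerateTwoPoint_of_pinnedLimit`: EVERY pointwise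
  limit for `ρ = ρ_pin` is non-degenerate.
* `tendstoLocallyUniformlyOn_of_ratio`: change of renormalisation by a convergent factor
  (`ρ'ⁿ/ρⁿ → L`) maps a locally uniform limit `S n` to `L · S n` (local boundedness of `S n` is free).
* `moebiusLimit_iff_pinnedLimit`: `MoebiusLimit ↔ ∃ Δ S, PinnedLimit Δ S` — the crux loses nothing
  by pinning `ρ := ρ_pin` (rescale a witness by `S₂(0,e₀)^{-n/2}`; `ρ_pin/ρ → S₂(0,e₀)^{-1/2}`).
* `moebiusLimit_iff_pinned_inversion`: **`MoebiusLimit ↔ ∃ Δ S, HasPointwiseScalingLimit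
  (criticalCorr 3) rhoPin S ∧ IsInversionCovariant Δ S`** — THE CRUX IN TWO CLAUSES: the pinned zoom
  of the critical correlators converges (locally uniformly off diagonals, all `n`) to a family
  covariant under `x ↦ x/‖x‖²`; `ρ`, `0 < Δ`, non-degeneracy, translations, rotations, dilations
  are all eliminated (gen-2 `moebiusLimit_iff_inversion` + the above); and the sub-problem
  `critIsing3DConformalLimit_iff_pinned_inversion` adds only `U₄ ≢ 0`.
Relation to the deep-refuter's tightness files (landed in parallel): `Negative/PinnedClusterPoints.lean`
has the exact pinning identity (`rescaled_pin_cfg01`) and the POINTWISE/sequence form of the forward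
direction (`rescaled_pin_eq`, `tendsto_rescaled_pin`, `clusterPoint_eq`), and
`Negative/OnlyInteractionTightness.lean` its locally uniform sequence form (`stub1_of_crux`); the
present file adds the full-filter `iff` packaging and the CONVERSE direction, which rests on the
automatic non-degeneracy of pinned limits (`Negative/TwoPointPositivity.lean`).
-/

noncomputable section

namespace Summit.CriticalPhenomena.Ising3DConformalLimit.MoebiusLimitExistsNegative

open Literature.Probability.LatticeModels Filter Set
open Summit.CriticalPhenomena.Ising3DConformalLimit.MoebiusLimitExistsOnlyInteraction
open scoped Topology

variable {ρ : ℝ → ℝ} {S : CorrFamily 3}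


/-! ### The pinned renormalisation `ρ_pin` -/

/-- `⟨σ₀ σ_{⌊1/δ⌋e₀}⟩_{β_c} > 0` for `δ ∈ (0,1]` (Simon–Lieb lower bound at a non-zero site).
[cite: Simon1980, Thm. 1] -/
theorem criticalTwoPoint_floor_pos {δ : ℝ} (hδ : δ ∈ Set.Ioc (0:ℝ) 1) :
    0 < criticalTwoPoint 3 (Pi.single (0 : Fin 3) ⌊1 / δ⌋) := by
  obtain ⟨c, C, hc, hb⟩ := criticalTwoPoint_bounds_holds (d := 3) le_rfl
  have hm1 : (1 : ℤ) ≤ ⌊1 / δ⌋ := Int.le_floor.2 (by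
    rw [Int.cast_one]
    exact one_le_one_div hδ.1 hδ.2)
  have hx : (Pi.single 0 (⌊1 / δ⌋ : ℤ) : Site 3) ≠ 0 := by
    intro h
    have h0 := congr_fun h 0
    simp only [Pi.single_eq_same, Pi.zero_apply] at h0
    omega
  have hpos : 0 < c * (‖(Pi.single 0 (⌊1 / δ⌋ : ℤ) : Site 3)‖ : ℝ) ^ (-((3 : ℝ) - 1)) :=
    mul_pos hc (Real.rpow_pos_of_pos (norm_pos_iff.2 hx) _)
  exact lt_of_lt_of_le hpos (hb _ hx).1

/-- **The pinned zoom is exactly `1` at the unit axis pair**: `ρ_pin(δ)² ⟨σ₀ σ_{⌊1/δ⌋e₀}⟩ = 1` for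
`δ ∈ (0,1]`. [folklore] -/
theorem rescaledCorrelator_rhoPin_unit {δ : ℝ} (hδ : δ ∈ Set.Ioc (0:ℝ) 1) :
    rescaledCorrelator (criticalCorr 3) rhoPin 2 δ ((![0, EuclideanSpace.single 0 1] : Fin 2 → EuclideanSpace ℝ (Fin 3))) = 1 := by
  rw [rescaledCorrelator_axisPair]
  have hG := criticalTwoPoint_floor_pos hδ
  unfold rhoPin
  rw [← Real.rpow_natCast, ← Real.rpow_mul hG.le]
  rw [show (-(1 / 2 : ℝ) * ((2:ℕ) : ℝ)) = -1 by norm_num, Real.rpow_neg_one, inv_mul_cancel₀ hG.ne']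

/-- **Every pinned limit has `S₂(0, e₀) = 1`.** [folklore] -/
theorem pinned_two_point_unit (hlim : HasPointwiseScalingLimit (criticalCorr 3) rhoPin S) :
    S 2 ((![0, EuclideanSpace.single 0 1] : Fin 2 → EuclideanSpace ℝ (Fin 3))) = 1 := by
  have h := (hlim 2).tendsto_at (zero_unitVec_mem_nonCoincident (one_ne_zero (α := ℝ)))
  have h1 : Tendsto (fun δ => rescaledCorrelator (criticalCorr 3) rhoPin 2 δ ((![0, EuclideanSpace.single 0 1] : Fin 2 → EuclideanSpace ℝ (Fin 3)))) (𝓝[>] (0:ℝ))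
      (𝓝 1) := by
    refine tendsto_const_nhds.congr' ?_
    filter_upwards [Ioc_mem_nhdsGT one_pos] with δ hδ
    exact (rescaledCorrelator_rhoPin_unit hδ).symm
  exact tendsto_nhds_unique h h1

/-- **NON-DEGENERACY IS AUTOMATIC FOR THE PINNED RENORMALISATION**: every pointwise scaling limit of
the critical correlators with `ρ = ρ_pin` has `S₂ > 0` on all non-coincident pairs. [folklore] -/
theorem isNondegenerateTwoPoint_of_pinnedLimit (hlim : HasPointwiseScalingLimit (criticalCorr 3) rhoPin S) :
    IsNondegenerateTwoPoint S :=
  isNondegenerateTwoPoint_of_pos hlim (zero_unitVec_mem_nonCoincident one_ne_zero)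
    (by rw [show (![0, EuclideanSpace.single 0 1] : Fin 2 → EuclideanSpace ℝ (Fin 3)) = (![0, EuclideanSpace.single 0 1] : Fin 2 → EuclideanSpace ℝ (Fin 3)) from rfl,
      pinned_two_point_unit hlim]; exact one_pos)

/-! ### Changing the renormalisation by a convergent factor -/

/-- **Change of renormalisation.** If the `ρ`-rescaled `n`-point correlators converge locally
uniformly on `NonCoincident` to `S n`, `ρ ≠ 0` eventually, and `ρ'(δ)ⁿ/ρ(δ)ⁿ → L`, then the
`ρ'`-rescaled correlators converge locally uniformly to `L · S n`. (The limit `S n` need not be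
continuous: it is locally bounded because ONE rescaled correlator `ρ(δ₁)ⁿ⟨∏σ⟩` is bounded by
`|ρ(δ₁)|ⁿ`.) [folklore] -/
theorem tendstoLocallyUniformlyOn_of_ratio {ρ ρ' : ℝ → ℝ} {S : CorrFamily 3} {n : ℕ} {L : ℝ}
    (h : TendstoLocallyUniformlyOn (rescaledCorrelator (criticalCorr 3) ρ n) (S n) (𝓝[>] (0:ℝ))
      (NonCoincident 3 n))
    (hρ : ∀ᶠ δ in 𝓝[>] (0:ℝ), ρ δ ≠ 0)
    (hc : Tendsto (fun δ => ρ' δ ^ n / ρ δ ^ n) (𝓝[>] (0:ℝ)) (𝓝 L)) :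
    TendstoLocallyUniformlyOn (rescaledCorrelator (criticalCorr 3) ρ' n) (fun x => L * S n x)
      (𝓝[>] (0:ℝ)) (NonCoincident 3 n) := by
  rw [Metric.tendstoLocallyUniformlyOn_iff] at h ⊢
  intro ε hε x hx
  -- a local bound on `S n` near `x`
  obtain ⟨t₁, ht₁, hev₁⟩ := h 1 one_pos x hx
  obtain ⟨δ₁, hδ₁⟩ := hev₁.exists
  set B : ℝ := |ρ δ₁| ^ n + 1 with hB
  have hB0 : 0 < B := by positivity
  have hbound : ∀ y ∈ t₁, |S n y| ≤ B := by
    intro y hy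
    have h1 := hδ₁ y hy
    rw [Real.dist_eq] at h1
    have h2 : |rescaledCorrelator (criticalCorr 3) ρ n δ₁ y| ≤ |ρ δ₁| ^ n := by
      rw [rescaledCorrelator_apply, abs_mul, abs_pow]
      exact mul_le_of_le_one_right (pow_nonneg (abs_nonneg _) _) (abs_criticalCorr_le_one le_rfl _ _)
    have h3 := abs_sub_abs_le_abs_sub (S n y) (rescaledCorrelator (criticalCorr 3) ρ n δ₁ y)
    linarith
  -- the two smallness conditions
  set ε₂ : ℝ := min 1 (ε / (2 * (|L| + 1))) with hε₂
  have hε₂0 : 0 < ε₂ := lt_min one_pos (by positivity)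
  obtain ⟨t₂, ht₂, hev₂⟩ := h ε₂ hε₂0 x hx
  have hcev : ∀ᶠ δ in 𝓝[>] (0:ℝ), dist (ρ' δ ^ n / ρ δ ^ n) L < ε / (2 * (B + 1)) :=
    Metric.tendsto_nhds.1 hc _ (by positivity)
  refine ⟨t₁ ∩ t₂, inter_mem ht₁ ht₂, ?_⟩
  filter_upwards [hev₂, hcev, hρ] with δ h2 hcδ hρδ y hy
  obtain ⟨hy1, hy2⟩ := hy
  set c : ℝ := ρ' δ ^ n / ρ δ ^ n with hcdef
  set R : ℝ := rescaledCorrelator (criticalCorr 3) ρ n δ y with hR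
  set f : ℝ := S n y with hf
  have hρn : ρ δ ^ n ≠ 0 := pow_ne_zero n hρδ
  have hR' : rescaledCorrelator (criticalCorr 3) ρ' n δ y = c * R := by
    rw [hR, hcdef, rescaledCorrelator_apply, rescaledCorrelator_apply]
    field_simp
  rw [hR', Real.dist_eq]
  have hfR : |f - R| < ε₂ := by have := h2 y hy2; rwa [Real.dist_eq] at this
  have hfR1 : |f - R| < 1 := lt_of_lt_of_le hfR (min_le_left _ _)
  have hfR2 : |f - R| < ε / (2 * (|L| + 1)) := lt_of_lt_of_le hfR (min_le_right _ _)
  have hcL : |L - c| < ε / (2 * (B + 1)) := by rw [abs_sub_comm]; rwa [Real.dist_eq] at hcδ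
  have hRle : |R| ≤ B + 1 := by
    have h3 := abs_sub_abs_le_abs_sub R f
    rw [abs_sub_comm] at h3
    linarith [hbound y hy1]
  have hsplit : L * f - c * R = L * (f - R) + (L - c) * R := by ring
  have hT1 : |L| * |f - R| ≤ ε / 2 := by
    have h1 : |L| * |f - R| ≤ |L| * (ε / (2 * (|L| + 1))) :=
      mul_le_mul_of_nonneg_left hfR2.le (abs_nonneg L)
    have h2 : |L| * (ε / (2 * (|L| + 1))) ≤ ε / 2 := by
      rw [mul_div_assoc']
      rw [div_le_div_iff₀ (by positivity) (by positivity)]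
      nlinarith [abs_nonneg L]
    linarith
  have hT2 : |L - c| * |R| < ε / 2 := by
    calc |L - c| * |R| ≤ |L - c| * (B + 1) := mul_le_mul_of_nonneg_left hRle (abs_nonneg _)
      _ < ε / (2 * (B + 1)) * (B + 1) := mul_lt_mul_of_pos_right hcL (by positivity)
      _ = ε / 2 := by field_simp
  calc |L * f - c * R| = |L * (f - R) + (L - c) * R| := by rw [hsplit]
    _ ≤ |L * (f - R)| + |(L - c) * R| := abs_add_le _ _
    _ = |L| * |f - R| + |L - c| * |R| := by rw [abs_mul, abs_mul]
    _ < ε := by linarith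

/-! ### Headline: `ρ` is WLOG `ρ_pin`, and then everything but the limit and the inversion is automatic -/

/-- Multiplying the `n`-point functions by `aⁿ` preserves Möbius covariance. [folklore] -/
theorem isMoebiusCovariant_pow_mul {Δ : ℝ} {S : CorrFamily 3} (a : ℝ) (h : IsMoebiusCovariant Δ S) :
    IsMoebiusCovariant Δ (fun n x => a ^ n * S n x) := by
  obtain ⟨⟨htr, hrot⟩, hsc, hinv⟩ := h
  refine ⟨⟨fun n v x => ?_, fun n R x => ?_⟩, fun n c hc x => ?_, fun n x hx => ?_⟩
  · simp only [htr n v x]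
  · simp only [hrot n R x]
  · simp only [hsc n c hc x]; ring
  · simp only [hinv n x hx]; ring

/-- For a witness `(ρ, S)` of the crux, `ρ_pin(δ)/ρ(δ) → S₂(0,e₀)^{-1/2}`. [folklore] -/
theorem tendsto_rhoPin_div (hρ : ∀ δ ∈ Set.Ioc (0:ℝ) 1, 0 < ρ δ)
    (hlim : HasPointwiseScalingLimit (criticalCorr 3) ρ S) (hA : 0 < S 2 ((![0, EuclideanSpace.single 0 1] : Fin 2 → EuclideanSpace ℝ (Fin 3)))) :
    Tendsto (fun δ => rhoPin δ / ρ δ) (𝓝[>] (0:ℝ)) (𝓝 (S 2 ((![0, EuclideanSpace.single 0 1] : Fin 2 → EuclideanSpace ℝ (Fin 3))) ^ (-(1 / 2 : ℝ)))) := by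
  have hT := (tendsto_axisPair hlim (one_ne_zero (α := ℝ))).rpow_const (p := -(1 / 2 : ℝ)) (Or.inl hA.ne')
  refine hT.congr' ?_
  filter_upwards [Ioc_mem_nhdsGT one_pos] with δ hδ
  have hρ0 := hρ δ hδ
  have hG := criticalTwoPoint_floor_pos hδ
  rw [Real.mul_rpow (sq_nonneg _) hG.le, ← Real.rpow_natCast (ρ δ) 2, ← Real.rpow_mul hρ0.le,
    show (((2:ℕ):ℝ) * -(1 / 2 : ℝ)) = -1 by norm_num, Real.rpow_neg_one]
  unfold rhoPin
  exact (div_eq_inv_mul _ _).symm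

/-- **`ρ` IS WLOG THE PINNED RENORMALISATION**: `MoebiusLimit ↔ ∃ Δ S, PinnedLimit Δ S`, i.e. the
crux holds iff the PINNED zoom `ρ_pin(δ)ⁿ ⟨σ_{[x₁/δ]} ⋯ σ_{[xₙ/δ]}⟩_{β_c}` has a non-degenerate Möbius
covariant pointwise limit (rescale a witness `S` by `S₂(0,e₀)^{-n/2}`). The line
`only-interaction-breaks-moebius` therefore loses nothing by pinning. [folklore] -/
theorem moebiusLimit_iff_pinnedLimit :
    Summit.CriticalPhenomena.Ising3DConformalLimit.Theses.EnergyNotSigmaSquared.MoebiusLimit ↔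
      ∃ (Δ : ℝ) (S : CorrFamily 3), PinnedLimit Δ S := by
  constructor
  · rintro ⟨ρ, Δ, S, hρ, -, hlim, hnd, hM⟩
    have hA : 0 < S 2 ((![0, EuclideanSpace.single 0 1] : Fin 2 → EuclideanSpace ℝ (Fin 3))) := hnd _ (zero_unitVec_mem_nonCoincident one_ne_zero)
    set a : ℝ := S 2 ((![0, EuclideanSpace.single 0 1] : Fin 2 → EuclideanSpace ℝ (Fin 3))) ^ (-(1 / 2 : ℝ)) with ha
    have ha0 : 0 < a := Real.rpow_pos_of_pos hA _
    refine ⟨Δ, fun n x => a ^ n * S n x, fun n => ?_, fun x hx => ?_, isMoebiusCovariant_pow_mul a hM⟩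
    · refine tendstoLocallyUniformlyOn_of_ratio (hlim n) ?_ ?_
      · filter_upwards [Ioc_mem_nhdsGT one_pos] with δ hδ using (hρ δ hδ).ne'
      · have h := (tendsto_rhoPin_div hρ hlim hA).pow n
        refine h.congr' (Eventually.of_forall fun δ => ?_)
        simp only [div_pow]
    · exact mul_pos (pow_pos ha0 2) (hnd x hx)
  · rintro ⟨Δ, S, hlim, hnd, hM⟩
    exact moebiusLimit_iff_without_delta_pos.2 ⟨rhoPin, Δ, S, rhoPin_pos, hlim, hnd, hM⟩

/-- **THE CRUX IN TWO CLAUSES**: `MoebiusLimit ↔ ∃ Δ S, HasPointwiseScalingLimit (criticalCorr 3)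
rhoPin S ∧ IsInversionCovariant Δ S` — the pinned zoom of the critical `ℤ³` correlators converges
(locally uniformly off the diagonals, every `n`) to a family covariant under `x ↦ x/‖x‖²`. The
renormalisation, `0 < Δ`, non-degeneracy (`isNondegenerateTwoPoint_of_pinnedLimit`), translations,
rotations and dilations (`moebiusLimit_iff_inversion`) are all eliminated. [folklore] -/
theorem moebiusLimit_iff_pinned_inversion :
    Summit.CriticalPhenomena.Ising3DConformalLimit.Theses.EnergyNotSigmaSquared.MoebiusLimit ↔
      ∃ (Δ : ℝ) (S : CorrFamily 3),
        HasPointwiseScalingLimit (criticalCorr 3) rhoPin S ∧ IsInversionCovariant Δ S := by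
  constructor
  · intro h
    obtain ⟨Δ, S, hlim, -, hM⟩ := moebiusLimit_iff_pinnedLimit.1 h
    exact ⟨Δ, S, hlim, hM.2.2⟩
  · rintro ⟨Δ, S, hlim, hinv⟩
    exact moebiusLimit_iff_inversion.2
      ⟨rhoPin, Δ, S, rhoPin_pos, hlim, isNondegenerateTwoPoint_of_pinnedLimit hlim, hinv⟩

/-- `U₄` of the rescaled family `aⁿ S` is `a⁴ U₄(S)`. [folklore] -/
theorem limitConnectedFour_pow_mul (a : ℝ) (S : CorrFamily 3) (x : Fin 4 → EuclideanSpace ℝ (Fin 3)) :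
    limitConnectedFour (fun n x => a ^ n * S n x) x = a ^ 4 * limitConnectedFour S x := by
  simp only [limitConnectedFour]
  ring

/-- **THE SUB-PROBLEM IN THREE CLAUSES**: `CritIsing3DConformalLimit ↔ ∃ Δ S, (pinned limit) ∧
(inversion covariance) ∧ U₄ ≢ 0`. [folklore] -/
theorem critIsing3DConformalLimit_iff_pinned_inversion :
    CritIsing3DConformalLimit ↔
      ∃ (Δ : ℝ) (S : CorrFamily 3), HasPointwiseScalingLimit (criticalCorr 3) rhoPin S ∧
        IsInversionCovariant Δ S ∧ HasNontrivialU4 S := by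
  constructor
  · rintro ⟨ρ, Δ, S, hρ, -, hlim, hnd, hM, hU⟩
    have hA : 0 < S 2 ((![0, EuclideanSpace.single 0 1] : Fin 2 → EuclideanSpace ℝ (Fin 3))) := hnd _ (zero_unitVec_mem_nonCoincident one_ne_zero)
    set a : ℝ := S 2 ((![0, EuclideanSpace.single 0 1] : Fin 2 → EuclideanSpace ℝ (Fin 3))) ^ (-(1 / 2 : ℝ)) with ha
    have ha0 : 0 < a := Real.rpow_pos_of_pos hA _
    refine ⟨Δ, fun n x => a ^ n * S n x, fun n => ?_, (isMoebiusCovariant_pow_mul a hM).2.2, ?_⟩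
    · refine tendstoLocallyUniformlyOn_of_ratio (hlim n) ?_ ?_
      · filter_upwards [Ioc_mem_nhdsGT one_pos] with δ hδ using (hρ δ hδ).ne'
      · have h := (tendsto_rhoPin_div hρ hlim hA).pow n
        refine h.congr' (Eventually.of_forall fun δ => ?_)
        simp only [div_pow]
    · obtain ⟨x, hx, hne⟩ := hU
      refine ⟨x, hx, ?_⟩
      rw [limitConnectedFour_pow_mul]
      exact mul_ne_zero (pow_ne_zero 4 ha0.ne') hne
  · rintro ⟨Δ, S, hlim, hinv, hU⟩
    exact critIsing3DConformalLimit_iff_inversion.2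
      ⟨rhoPin, Δ, S, rhoPin_pos, hlim, isNondegenerateTwoPoint_of_pinnedLimit hlim, hinv, hU⟩

end Summit.CriticalPhenomena.Ising3DConformalLimit.MoebiusLimitExistsNegative

end
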